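import Literature.Probability.Percolation.GluingRDE
import Literature.Probability.Percolation.PlanarCoinGlue

/-!
# Collapse of the planarity-corrected gluing RDE `Ψ_k` on connected inputs
(crux `CardyGluingRDE.GluingContraction`, stmt-CriticalPhenomena-8580, line `birth`)

The line `birth` for the crux `GluingContraction` models mesh-halving of the square by
`Ψ_k = gluingRDE planarCoinGlue (uniform coins)` read on the true bond-`ℤ²` / site-`𝕋` laws of the
resolution-`k` boundary-segment connectivity matrices.  This file records the combinatorial fact
that makes the line degenerate: call a matrix `M : ArcRel k` CONNECTED when every two segments are
related by the equivalence closure of `M · · = true` (e.g. when all pairs of ADJACENT boundary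
segments are joined — which the `≤`-ties of `discreteArc` force for every configuration at a
commensurable mesh, and which holds with probability `→ 1` as the mesh tends to `0` in general).
Since `chainRel` is the `Relation.EqvGen` closure of `GlueLink ⊇` "joined inside a quadrant", the
four quadrants of the `2 × 2` picture are single blocks for connected inputs, and since
`gate X Y ξ a = !Contested || ξ a` is `true` whenever the coin `ξ a` is `true`, quadrants `h` and
`h + 1` are chained as soon as ONE of the `k` coins of half-seam `h` is `true`.  Hence:

* `psiCollapse_primal_eq_true` — connected primal inputs and a `true` coin on each of the half-seams
  `0, 1, 2` force the glued PRIMAL matrix to be identically `true`;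
* `psiCollapse_uniform_goodCoins_ge` — under the uniform coin law this coin event has probability
  `≥ 1 − 3·2^{-k}`;
* `psiCollapse_allJoined_ge` — for every law `μ` on `BoxArcState k`,
  `(1 − 3·2^{-k}) · μ{connected primal}^4 ≤ (Ψ_k μ){primal ≡ true}`;
* `psiCollapse_allJoined_ge_real` / `gluingRDE_planarCoinGlue_allJoined_ge` (registered ∀-form) — the
  real-valued form for laws supported on connected states: `1 − 3·2^{-k} ≤ (Ψ_k μ)(B)` for every event `B ⊇ {primal ≡ true}`;
* `psiCollapse_dual_eq_true` — the dual twin (duality equivariance `planarCoinGlue_swap`): connected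
  DUAL inputs and a `false` coin on each of the half-seams `0, 1, 2` force the glued dual matrix to
  be identically `true`; `psiCollapse_allJoined_step` — the collapsed event is absorbing up to
  `3·2^{-k}` (`(1 − 3·2^{-k}) · μ{primal ≡ true}^4 ≤ (Ψ_k μ){primal ≡ true}`), so iterates stay
  collapsed.

So `Ψ_k` sends every law carried by connected states `3·2^{-k}`-close (on this event) to the point
mass at "everything joined", whatever the law: the glued predictions of the line carry no
information about the input, which is what kills its shadowing stubs.  Pure combinatorics of the
tree definitions `planarCoinGlue` / `gluingRDE`; no percolation input.
-/

noncomputable section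

namespace Summit.CriticalPhenomena.CardyFormulaZ2.Theorems

open scoped ENNReal
open MeasureTheory Literature.Probability.Percolation Literature.Probability.Distributions

variable {k : ℕ}

/-! ### Connected matrices (every two segments related by the equivalence closure of "joined")
and the chaining inside one quadrant -/

/-- For a connected matrix in quadrant `q`, all nodes of quadrant `q` are chained (the links of
`GlueLink` inside a quadrant are the joined pairs, and chaining is their equivalence closure).
[folklore] -/
theorem psiCollapse_eqvGen_quadrant (X : Fin 4 → ArcRel k) (g : Fin 4 × Fin k → Bool) (q : Fin 4)
    (hX : ∀ a b : Fin 4 × Fin k, Relation.EqvGen (fun x y => X q x y = true) a b)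
    (s s' : Fin 4 × Fin k) :
    Relation.EqvGen (GlueLink X g) (q, s) (q, s') := by
  have h := hX s s'
  induction h with
  | rel x y hxy => exact .rel _ _ (Or.inl ⟨rfl, hxy⟩)
  | refl x => exact .refl _
  | symm x y _ ih => exact .symm _ _ ih
  | trans x y z _ _ ih₁ ih₂ => exact .trans _ _ _ ih₁ ih₂

/-- An open arc on half-seam `h` chains quadrant `h` to quadrant `h + 1` (for connected inputs).
[folklore] -/
theorem psiCollapse_eqvGen_step (X : Fin 4 → ArcRel k) (g : Fin 4 × Fin k → Bool)
    (hX : ∀ q, ∀ a b : Fin 4 × Fin k, Relation.EqvGen (fun x y => X q x y = true) a b)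
    (h : Fin 4) (hg : ∃ j, g (h, j) = true)
    (s s' : Fin 4 × Fin k) :
    Relation.EqvGen (GlueLink X g) (h, s) (h + 1, s') := by
  obtain ⟨j, hj⟩ := hg
  have harc : Relation.EqvGen (GlueLink X g) (arcFst (h, j)) (arcSnd (h, j)) :=
    .rel _ _ (Or.inr ⟨(h, j), hj, Or.inl ⟨rfl, rfl⟩⟩)
  exact ((psiCollapse_eqvGen_quadrant X g h (hX h) s (h + 1, j.rev)).trans _ _ _ harc).trans _ _ _
    (psiCollapse_eqvGen_quadrant X g (h + 1) (hX (h + 1)) (h + 3, j) s')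

/-- With connected inputs and an open arc on each of the half-seams `0, 1, 2`, every node is
chained to every node of quadrant `0`. [folklore] -/
theorem psiCollapse_eqvGen_zero (X : Fin 4 → ArcRel k) (g : Fin 4 × Fin k → Bool)
    (hX : ∀ q, ∀ a b : Fin 4 × Fin k, Relation.EqvGen (fun x y => X q x y = true) a b)
    (hg : ∀ h : Fin 4, h ≠ 3 → ∃ j, g (h, j) = true)
    (s : Fin 4 × Fin k) (x : GlueNode k) :
    Relation.EqvGen (GlueLink X g) (0, s) x := by
  obtain ⟨q, s'⟩ := x
  have h0 : ∀ t : Fin 4 × Fin k, Relation.EqvGen (GlueLink X g) (0, s) (1, t) := fun t =>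
    psiCollapse_eqvGen_step X g hX 0 (hg 0 (by decide)) s t
  have h1 : ∀ t : Fin 4 × Fin k, Relation.EqvGen (GlueLink X g) (0, s) (2, t) := fun t =>
    (h0 s).trans _ _ _ (psiCollapse_eqvGen_step X g hX 1 (hg 1 (by decide)) s t)
  have h2 : ∀ t : Fin 4 × Fin k, Relation.EqvGen (GlueLink X g) (0, s) (3, t) := fun t =>
    (h1 s).trans _ _ _ (psiCollapse_eqvGen_step X g hX 2 (hg 2 (by decide)) s t)
  fin_cases q
  · exact psiCollapse_eqvGen_quadrant X g 0 (hX 0) s s'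
  · exact h0 s'
  · exact h1 s'
  · exact h2 s'

/-- With connected inputs and an open arc on each of the half-seams `0, 1, 2`, ALL nodes of the
gluing graph are chained together. [folklore] -/
theorem psiCollapse_eqvGen_all (X : Fin 4 → ArcRel k) (g : Fin 4 × Fin k → Bool)
    (hX : ∀ q, ∀ a b : Fin 4 × Fin k, Relation.EqvGen (fun x y => X q x y = true) a b)
    (hg : ∀ h : Fin 4, h ≠ 3 → ∃ j, g (h, j) = true)
    (x y : GlueNode k) : Relation.EqvGen (GlueLink X g) x y :=
  ((psiCollapse_eqvGen_zero X g hX hg x.2 x).symm _ _).trans _ _ _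
    (psiCollapse_eqvGen_zero X g hX hg x.2 y)

/-- Hence the one-species gluing of connected inputs through such gates is identically `true`.
[folklore] -/
theorem psiCollapse_glueSpecies_eq_true (X : Fin 4 → ArcRel k) (g : Fin 4 × Fin k → Bool)
    (hX : ∀ q, ∀ a b : Fin 4 × Fin k, Relation.EqvGen (fun x y => X q x y = true) a b)
    (hg : ∀ h : Fin 4, h ≠ 3 → ∃ j, g (h, j) = true)
    (a b : Fin 4 × Fin k) : glueSpecies X g a b = true := by
  classical
  have hchain : ∀ u v, chainRel X g u v = true := fun u v => by
    unfold chainRel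
    exact decide_eq_true (psiCollapse_eqvGen_all X g hX hg _ _)
  unfold glueSpecies fuse
  exact decide_eq_true ⟨0, 0, hchain _ _⟩

/-- A `true` coin opens its arc to the first species, contested or not. [folklore] -/
theorem psiCollapse_gate_of_coin (X Y : Fin 4 → ArcRel k) (ξ : Fin 4 × Fin k → Bool)
    {a : Fin 4 × Fin k} (ha : ξ a = true) : gate X Y ξ a = true := by
  classical
  simp [gate, ha]

/-- **Collapse of the primal species.** If the four input states have connected primal matrices
and each of the half-seams `0, 1, 2` carries a `true` coin, the glued primal matrix of
`planarCoinGlue` is identically `true`. [folklore] -/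
theorem psiCollapse_primal_eq_true (S : Fin 4 → BoxArcState k) (ξ : Fin 4 × Fin k → Bool)
    (hS : ∀ q, ∀ a b : Fin 4 × Fin k, Relation.EqvGen (fun x y => (S q).primal x y = true) a b)
    (hξ : ξ ∈ {ξ : Fin 4 × Fin k → Bool | ∀ h : Fin 4, h ≠ 3 → ∃ j : Fin k, ξ (h, j) = true}) (a b : Fin 4 × Fin k) :
    (planarCoinGlue S ξ).primal a b = true := by
  show glueSpecies (fun q => (S q).primal)
      (gate (fun q => (S q).primal) (fun q => (S q).dual) ξ) a b = true
  refine psiCollapse_glueSpecies_eq_true _ _ hS (fun h hh => ?_) a b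
  obtain ⟨j, hj⟩ := hξ h hh
  exact ⟨j, psiCollapse_gate_of_coin _ _ ξ hj⟩

/-- Set form: for connected inputs, the good-coin event is contained in the preimage of
"primal identically `true`". [folklore] -/
theorem psiCollapse_goodCoins_subset (S : Fin 4 → BoxArcState k)
    (hS : ∀ q, ∀ a b : Fin 4 × Fin k, Relation.EqvGen (fun x y => (S q).primal x y = true) a b)
    :
    {ξ : Fin 4 × Fin k → Bool | ∀ h : Fin 4, h ≠ 3 → ∃ j : Fin k, ξ (h, j) = true} ⊆ planarCoinGlue S ⁻¹' {S : BoxArcState k | ∀ a b, S.primal a b = true} :=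
  fun _ hξ a b => psiCollapse_primal_eq_true S _ hS hξ a b

/-! ### The uniform coin law: `P(goodCoins) ≥ 1 − 3·2^{-k}` -/

/-- A coin string outside `goodCoins` is bad on one of the half-seams `0, 1, 2`. [folklore] -/
theorem psiCollapse_mem_badCoins_of_not_good {ξ : Fin 4 × Fin k → Bool}
    (hξ : ξ ∉ {ξ : Fin 4 × Fin k → Bool | ∀ h : Fin 4, h ≠ 3 → ∃ j : Fin k, ξ (h, j) = true}) :
    ξ ∈ {ξ : Fin 4 × Fin k → Bool | ∀ j : Fin k, ξ (0, j) = false} ∪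
      {ξ : Fin 4 × Fin k → Bool | ∀ j : Fin k, ξ (1, j) = false} ∪
      {ξ : Fin 4 × Fin k → Bool | ∀ j : Fin k, ξ (2, j) = false} := by
  simp only [Set.mem_setOf_eq, not_forall, not_exists, Bool.not_eq_true] at hξ
  obtain ⟨h, hh, hbad⟩ := hξ
  have hbad' : ξ ∈ {ξ : Fin 4 × Fin k → Bool | ∀ j : Fin k, ξ (h, j) = false} := hbad
  have hcases : ∀ h' : Fin 4, h' ≠ 3 → h' = 0 ∨ h' = 1 ∨ h' = 2 := by decide
  rcases hcases h hh with rfl | rfl | rfl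
  · exact Or.inl (Or.inl hbad')
  · exact Or.inl (Or.inr hbad')
  · exact Or.inr hbad'

/-- Counting: at most `2^{3k}` coin strings are bad on a given half-seam (restriction to the other
three half-seams is injective on them). [folklore] -/
theorem psiCollapse_card_badCoins_le (h : Fin 4) [Fintype ({ξ : Fin 4 × Fin k → Bool | ∀ j : Fin k, ξ (h, j) = false})] :
    Fintype.card ({ξ : Fin 4 × Fin k → Bool | ∀ j : Fin k, ξ (h, j) = false}) ≤ 2 ^ (3 * k) := by
  classical
  -- restriction to the coins off half-seam `h`
  let F : {ξ : Fin 4 × Fin k → Bool | ∀ j : Fin k, ξ (h, j) = false} → ({a : Fin 4 × Fin k // a.1 ≠ h} → Bool) := fun ξ a => ξ.1 a.1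
  have hF : Function.Injective F := by
    rintro ⟨ξ, hξ⟩ ⟨ξ', hξ'⟩ hFF
    refine Subtype.ext (funext fun a => ?_)
    by_cases ha : a.1 = h
    · have e : a = (h, a.2) := Prod.ext ha rfl
      rw [e]
      show ξ (h, a.2) = ξ' (h, a.2)
      rw [(hξ a.2 : ξ (h, a.2) = false), (hξ' a.2 : ξ' (h, a.2) = false)]
    · exact congrFun hFF ⟨a, ha⟩
  have hcard := Fintype.card_le_of_injective F hF
  have hrow : k ≤ Fintype.card {a : Fin 4 × Fin k // a.1 = h} := by
    have hi : Function.Injective (fun j : Fin k => (⟨(h, j), rfl⟩ : {a : Fin 4 × Fin k // a.1 = h})) :=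
      fun j j' hjj => by simpa using congrArg (fun a => a.1.2) hjj
    simpa using Fintype.card_le_of_injective _ hi
  have hcompl : Fintype.card {a : Fin 4 × Fin k // a.1 ≠ h} ≤ 3 * k := by
    rw [Fintype.card_subtype_compl, Fintype.card_prod, Fintype.card_fin, Fintype.card_fin]
    omega
  calc Fintype.card ({ξ : Fin 4 × Fin k → Bool | ∀ j : Fin k, ξ (h, j) = false}) ≤ Fintype.card ({a : Fin 4 × Fin k // a.1 ≠ h} → Bool) := hcard
    _ = 2 ^ Fintype.card {a : Fin 4 × Fin k // a.1 ≠ h} := by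
        rw [Fintype.card_fun, Fintype.card_bool]
    _ ≤ 2 ^ (3 * k) := Nat.pow_le_pow_right (by norm_num) hcompl

/-- Under the uniform coin law a given half-seam is bad with probability `≤ 2^{-k}`. [folklore] -/
theorem psiCollapse_uniform_badCoins_le (h : Fin 4) :
    (PMF.uniformOfFintype (Fin 4 × Fin k → Bool)).toOuterMeasure ({ξ : Fin 4 × Fin k → Bool | ∀ j : Fin k, ξ (h, j) = false}) ≤
      ((2 : ℝ≥0∞) ^ k)⁻¹ := by
  classical
  rw [PMF.toOuterMeasure_uniformOfFintype_apply]
  have hC : (Fintype.card (Fin 4 × Fin k → Bool) : ℝ≥0∞) = 2 ^ k * 2 ^ (3 * k) := by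
    rw [Fintype.card_fun, Fintype.card_bool, Fintype.card_prod, Fintype.card_fin, Fintype.card_fin,
      ← pow_add]
    push_cast
    ring
  have h2k : (2 : ℝ≥0∞) ^ k ≠ 0 := pow_ne_zero _ two_ne_zero
  have h2k' : (2 : ℝ≥0∞) ^ k ≠ ∞ := ENNReal.pow_ne_top ENNReal.ofNat_ne_top
  have hnum : (Fintype.card ({ξ : Fin 4 × Fin k → Bool | ∀ j : Fin k, ξ (h, j) = false}) : ℝ≥0∞) ≤ 2 ^ (3 * k) := by
    exact_mod_cast psiCollapse_card_badCoins_le (k := k) h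
  rw [hC, ENNReal.div_le_iff_le_mul (Or.inl (mul_ne_zero h2k (pow_ne_zero _ two_ne_zero)))
    (Or.inl (ENNReal.mul_ne_top h2k' (ENNReal.pow_ne_top ENNReal.ofNat_ne_top))),
    ← mul_assoc, ENNReal.inv_mul_cancel h2k h2k', one_mul]
  exact hnum

/-- **The good coins have probability `≥ 1 − 3·2^{-k}`** under the uniform coin law. [folklore] -/
theorem psiCollapse_uniform_goodCoins_ge :
    1 - 3 * ((2 : ℝ≥0∞) ^ k)⁻¹ ≤
      (PMF.uniformOfFintype (Fin 4 × Fin k → Bool)).toOuterMeasure ({ξ : Fin 4 × Fin k → Bool | ∀ h : Fin 4, h ≠ 3 → ∃ j : Fin k, ξ (h, j) = true}) := by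
  classical
  set θ := PMF.uniformOfFintype (Fin 4 × Fin k → Bool) with hθ
  -- `1 ≤ θ(good) + θ(bad₀ ∪ bad₁ ∪ bad₂)` pointwise
  have hsplit : (1 : ℝ≥0∞) ≤ θ.toOuterMeasure ({ξ : Fin 4 × Fin k → Bool | ∀ h : Fin 4, h ≠ 3 → ∃ j : Fin k, ξ (h, j) = true}) +
      θ.toOuterMeasure ({ξ : Fin 4 × Fin k → Bool | ∀ j : Fin k, ξ (0, j) = false} ∪ {ξ : Fin 4 × Fin k → Bool | ∀ j : Fin k, ξ (1, j) = false} ∪ {ξ : Fin 4 × Fin k → Bool | ∀ j : Fin k, ξ (2, j) = false}) := by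
    rw [PMF.toOuterMeasure_apply_fintype, PMF.toOuterMeasure_apply_fintype, ← Finset.sum_add_distrib,
      ← θ.tsum_coe, tsum_fintype]
    refine Finset.sum_le_sum fun ξ _ => ?_
    by_cases hξ : ξ ∈ {ξ : Fin 4 × Fin k → Bool | ∀ h : Fin 4, h ≠ 3 → ∃ j : Fin k, ξ (h, j) = true}
    · rw [Set.indicator_of_mem hξ]
      exact le_self_add
    · rw [Set.indicator_of_mem (psiCollapse_mem_badCoins_of_not_good hξ)]
      exact le_add_self
  have hbad : θ.toOuterMeasure ({ξ : Fin 4 × Fin k → Bool | ∀ j : Fin k, ξ (0, j) = false} ∪ {ξ : Fin 4 × Fin k → Bool | ∀ j : Fin k, ξ (1, j) = false} ∪ {ξ : Fin 4 × Fin k → Bool | ∀ j : Fin k, ξ (2, j) = false}) ≤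
      3 * ((2 : ℝ≥0∞) ^ k)⁻¹ := by
    refine (measure_union_le _ _).trans ?_
    refine (add_le_add (measure_union_le _ _) le_rfl).trans ?_
    have h0 := psiCollapse_uniform_badCoins_le (k := k) 0
    have h1 := psiCollapse_uniform_badCoins_le (k := k) 1
    have h2 := psiCollapse_uniform_badCoins_le (k := k) 2
    calc θ.toOuterMeasure ({ξ : Fin 4 × Fin k → Bool | ∀ j : Fin k, ξ (0, j) = false}) + θ.toOuterMeasure ({ξ : Fin 4 × Fin k → Bool | ∀ j : Fin k, ξ (1, j) = false}) +
          θ.toOuterMeasure ({ξ : Fin 4 × Fin k → Bool | ∀ j : Fin k, ξ (2, j) = false})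
        ≤ ((2 : ℝ≥0∞) ^ k)⁻¹ + ((2 : ℝ≥0∞) ^ k)⁻¹ + ((2 : ℝ≥0∞) ^ k)⁻¹ :=
          add_le_add (add_le_add h0 h1) h2
      _ = 3 * ((2 : ℝ≥0∞) ^ k)⁻¹ := by ring
  calc 1 - 3 * ((2 : ℝ≥0∞) ^ k)⁻¹
      ≤ 1 - θ.toOuterMeasure ({ξ : Fin 4 × Fin k → Bool | ∀ j : Fin k, ξ (0, j) = false} ∪ {ξ : Fin 4 × Fin k → Bool | ∀ j : Fin k, ξ (1, j) = false} ∪ {ξ : Fin 4 × Fin k → Bool | ∀ j : Fin k, ξ (2, j) = false}) :=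
        tsub_le_tsub_left hbad 1
    _ ≤ θ.toOuterMeasure ({ξ : Fin 4 × Fin k → Bool | ∀ h : Fin 4, h ≠ 3 → ∃ j : Fin k, ξ (h, j) = true}) := tsub_le_iff_right.2 hsplit

/-! ### The law-level collapse -/

/-- **Collapse of `Ψ_k` (mass form).** For every law `μ` on resolution-`k` states,
`P_unif(goodCoins) · μ{connected primal}^4 ≤ (Ψ_k μ){primal ≡ true}`: glue four independent
`μ`-states with independent uniform coins; on the event that all four inputs are connected and the
coins are good the output is all-joined (`psiCollapse_primal_eq_true`). [folklore] -/
theorem psiCollapse_allJoined_ge_mass (μ : PMF (BoxArcState k)) :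
    (PMF.uniformOfFintype (Fin 4 × Fin k → Bool)).toOuterMeasure ({ξ : Fin 4 × Fin k → Bool | ∀ h : Fin 4, h ≠ 3 → ∃ j : Fin k, ξ (h, j) = true}) *
        μ.toOuterMeasure ({S : BoxArcState k | ∀ a b : Fin 4 × Fin k, Relation.EqvGen (fun x y => S.primal x y = true) a b}) ^ 4 ≤
      (gluingRDE planarCoinGlue (PMF.uniformOfFintype (Fin 4 × Fin k → Bool)) μ).toOuterMeasure
        ({S : BoxArcState k | ∀ a b, S.primal a b = true}) := by
  classical
  set θ := PMF.uniformOfFintype (Fin 4 × Fin k → Bool) with hθ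
  set Cn : Set (BoxArcState k) := {S : BoxArcState k | ∀ a b : Fin 4 × Fin k, Relation.EqvGen (fun x y => S.primal x y = true) a b} with hCn
  rw [gluingRDE_def, PMF.toOuterMeasure_bind_apply, tsum_fintype]
  simp_rw [PMF.toOuterMeasure_map_apply, indepLaw_apply]
  -- the fourth power of `μ(Cn)` as a sum over quadruples
  have hpow : μ.toOuterMeasure Cn ^ 4 =
      ∑ x : Fin 4 → BoxArcState k, ∏ i, Cn.indicator μ (x i) := by
    rw [PMF.toOuterMeasure_apply_fintype, Finset.sum_pow', Fintype.piFinset_univ]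
  rw [hpow, Finset.mul_sum]
  refine Finset.sum_le_sum fun x _ => ?_
  by_cases hx : ∀ i, x i ∈ Cn
  · have hprod : ∏ i, Cn.indicator μ (x i) = ∏ i, μ (x i) :=
      Finset.prod_congr rfl fun i _ => Set.indicator_of_mem (hx i) _
    rw [hprod, mul_comm]
    exact mul_le_mul' le_rfl
      (measure_mono (μ := θ.toOuterMeasure) (psiCollapse_goodCoins_subset x fun q => hx q))
  · obtain ⟨i, hi⟩ := not_forall.1 hx
    have hzero : ∏ i, Cn.indicator μ (x i) = 0 :=
      Finset.prod_eq_zero (Finset.mem_univ i) (Set.indicator_of_notMem hi _)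
    rw [hzero, mul_zero]
    exact bot_le

/-- **Collapse of `Ψ_k` (quantitative form).** For every law `μ` on resolution-`k` states,
`(1 − 3·2^{-k}) · μ{connected primal}^4 ≤ (Ψ_k μ){primal ≡ true}`. [folklore] -/
theorem psiCollapse_allJoined_ge (μ : PMF (BoxArcState k)) :
    (1 - 3 * ((2 : ℝ≥0∞) ^ k)⁻¹) * μ.toOuterMeasure ({S : BoxArcState k | ∀ a b : Fin 4 × Fin k, Relation.EqvGen (fun x y => S.primal x y = true) a b}) ^ 4 ≤
      (gluingRDE planarCoinGlue (PMF.uniformOfFintype (Fin 4 × Fin k → Bool)) μ).toOuterMeasure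
        ({S : BoxArcState k | ∀ a b, S.primal a b = true}) := by
  refine le_trans ?_ (psiCollapse_allJoined_ge_mass μ)
  gcongr
  exact psiCollapse_uniform_goodCoins_ge

/-- **Collapse of `Ψ_k` on laws carried by connected states (real form).** If every state in the
support of `μ` has a connected primal matrix (e.g. all adjacent boundary segments joined), then
for every event `B` containing "primal identically `true`",
`1 − 3·2^{-k} ≤ (Ψ_k μ)(B)`: the glued prediction is the point mass at "everything joined" up to
`3·2^{-k}`, whatever `μ` is. [folklore] -/
theorem psiCollapse_allJoined_ge_real (k : ℕ) (μ : PMF (BoxArcState k))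
    (hμ : ∀ S ∈ μ.support,
      ∀ a b : Fin 4 × Fin k, Relation.EqvGen (fun x y => S.primal x y = true) a b)
    {B : Set (BoxArcState k)} (hB : {S : BoxArcState k | ∀ a b, S.primal a b = true} ⊆ B) :
    1 - 3 * (2 : ℝ)⁻¹ ^ k ≤
      ((gluingRDE planarCoinGlue (PMF.uniformOfFintype (Fin 4 × Fin k → Bool)) μ).toOuterMeasure
        B).toReal := by
  set ν := gluingRDE planarCoinGlue (PMF.uniformOfFintype (Fin 4 × Fin k → Bool)) μ with hν
  have hone : μ.toOuterMeasure ({S : BoxArcState k | ∀ a b : Fin 4 × Fin k, Relation.EqvGen (fun x y => S.primal x y = true) a b}) = 1 :=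
    (PMF.toOuterMeasure_apply_eq_one_iff _ _).2 fun S hS => hμ S hS
  have hmain : 1 - 3 * ((2 : ℝ≥0∞) ^ k)⁻¹ ≤ ν.toOuterMeasure B := by
    have h := psiCollapse_allJoined_ge μ
    rw [hone, one_pow, mul_one] at h
    exact h.trans (measure_mono hB)
  have htop : ν.toOuterMeasure B ≠ ∞ :=
    ((measure_mono (Set.subset_univ B)).trans_lt (by
      rw [show ν.toOuterMeasure Set.univ = 1 from
        (PMF.toOuterMeasure_apply_eq_one_iff _ _).2 (Set.subset_univ _)]
      exact ENNReal.one_lt_top)).ne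
  have h3 : (3 * ((2 : ℝ≥0∞) ^ k)⁻¹) ≠ ∞ :=
    ENNReal.mul_ne_top (by norm_num) (ENNReal.inv_ne_top.2 (pow_ne_zero _ two_ne_zero))
  have hreal : ((1 : ℝ≥0∞) - 3 * ((2 : ℝ≥0∞) ^ k)⁻¹).toReal ≤ (ν.toOuterMeasure B).toReal :=
    (ENNReal.toReal_le_toReal (ne_top_of_le_ne_top ENNReal.one_ne_top tsub_le_self) htop).2 hmain
  have hsub : (1 : ℝ≥0∞).toReal - (3 * ((2 : ℝ≥0∞) ^ k)⁻¹).toReal ≤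
      ((1 : ℝ≥0∞) - 3 * ((2 : ℝ≥0∞) ^ k)⁻¹).toReal := ENNReal.le_toReal_sub h3
  have hval : (3 * ((2 : ℝ≥0∞) ^ k)⁻¹).toReal = 3 * (2 : ℝ)⁻¹ ^ k := by
    rw [ENNReal.toReal_mul, ENNReal.toReal_inv, ENNReal.toReal_pow, inv_pow]
    norm_num
  rw [ENNReal.toReal_one, hval] at hsub
  exact hsub.trans hreal

/-- **Collapse of `Ψ_k` on laws carried by connected states** — registered form (sub-goal
`gluingRDE_planarCoinGlue_allJoined_ge` of crux stmt-CriticalPhenomena-8580, line `birth`): for every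
resolution `k`, every law `μ` whose support consists of states with connected primal matrix, and
every event `B` containing "primal identically `true`", `1 − 3·2^{-k} ≤ (Ψ_k μ)(B)`. [folklore] -/
theorem gluingRDE_planarCoinGlue_allJoined_ge : ∀ (k : ℕ) (μ : PMF (BoxArcState k)), (∀ S ∈ μ.support, ∀ a b : Fin 4 × Fin k, Relation.EqvGen (fun x y => S.primal x y = true) a b) → ∀ B : Set (BoxArcState k), {S : BoxArcState k | ∀ a b, S.primal a b = true} ⊆ B → 1 - 3 * (2 : ℝ)⁻¹ ^ k ≤ ((gluingRDE planarCoinGlue (PMF.uniformOfFintype (Fin 4 × Fin k → Bool)) μ).toOuterMeasure B).toReal :=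
  fun k μ hμ _ hB => psiCollapse_allJoined_ge_real k μ hμ hB

/-- Negating the coins exchanges the two good events. [folklore] -/
theorem psiCollapse_not_mem_goodCoins {ξ : Fin 4 × Fin k → Bool} (hξ : ξ ∈ {ξ : Fin 4 × Fin k → Bool | ∀ h : Fin 4, h ≠ 3 → ∃ j : Fin k, ξ (h, j) = false}) :
    (fun a => !ξ a) ∈ {ξ : Fin 4 × Fin k → Bool | ∀ h : Fin 4, h ≠ 3 → ∃ j : Fin k, ξ (h, j) = true} := fun h hh => by
  obtain ⟨j, hj⟩ := hξ h hh
  exact ⟨j, by simp [hj]⟩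

/-- **Collapse of the dual species.** If the four input states have connected DUAL matrices and
each of the half-seams `0, 1, 2` carries a `false` coin, the glued dual matrix of `planarCoinGlue`
is identically `true` (duality equivariance `planarCoinGlue_swap` + the primal collapse).
[folklore] -/
theorem psiCollapse_dual_eq_true (S : Fin 4 → BoxArcState k) (ξ : Fin 4 × Fin k → Bool)
    (hS : ∀ q, ∀ a b : Fin 4 × Fin k, Relation.EqvGen (fun x y => (S q).dual x y = true) a b)
    (hξ : ξ ∈ {ξ : Fin 4 × Fin k → Bool | ∀ h : Fin 4, h ≠ 3 → ∃ j : Fin k, ξ (h, j) = false}) (a b : Fin 4 × Fin k) :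
    (planarCoinGlue S ξ).dual a b = true := by
  have hswap := planarCoinGlue_swap S ξ
  have h := psiCollapse_primal_eq_true (fun q => (S q).swap) (fun a => !ξ a) (fun q => hS q)
    (psiCollapse_not_mem_goodCoins hξ) a b
  rw [hswap] at h
  exact h

/-- The all-joined matrix is connected. [folklore] -/
theorem psiCollapse_allJoined_connected {S : BoxArcState k}
    (hS : S ∈ {S : BoxArcState k | ∀ a b, S.primal a b = true}) :
    ∀ a b : Fin 4 × Fin k, Relation.EqvGen (fun x y => S.primal x y = true) a b :=
  fun a b => .rel _ _ (hS a b)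

/-- **The collapsed event is absorbing up to `3·2^{-k}`**:
`(1 − 3·2^{-k}) · μ{primal ≡ true}^4 ≤ (Ψ_k μ){primal ≡ true}` for every law `μ`; in particular
the iterates of a collapsed law stay collapsed. [folklore] -/
theorem psiCollapse_allJoined_step (μ : PMF (BoxArcState k)) :
    (1 - 3 * ((2 : ℝ≥0∞) ^ k)⁻¹) * μ.toOuterMeasure ({S : BoxArcState k | ∀ a b, S.primal a b = true}) ^ 4 ≤
      (gluingRDE planarCoinGlue (PMF.uniformOfFintype (Fin 4 × Fin k → Bool)) μ).toOuterMeasure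
        ({S : BoxArcState k | ∀ a b, S.primal a b = true}) := by
  refine le_trans (mul_le_mul' le_rfl ?_) (psiCollapse_allJoined_ge μ)
  exact pow_le_pow_left₀ bot_le
    (measure_mono (μ := μ.toOuterMeasure) fun S hS => psiCollapse_allJoined_connected hS) 4


end Summit.CriticalPhenomena.CardyFormulaZ2.Theorems

end
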